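/-
Copyright (c) 2026 the pub-hodgecm-mathlib formalisation cell (harness21).  Prover seat hodgecm-mathlib-K2Liu-p11 (g2), Track B «K2-LIT»,
#184♮ = hLiu418 = `stmt-HodgeConjecture-24832`; organ (σ) A7-val, V6-inst LETTER 1b §2 = the `hBcont` SOCKET of ★ `K2LiuA7ValueInstanceFaceV2.faceA4R_two_of_record_v2`
(LEAD F0P6-plan (g14) BATCH #33 (2), my socket census 14:41Z TODO-2).  THEOREMS ONLY (no `def`, no `instance`, no notation, no named-fact hypothesis, no `sorry`).
-/
import Summits.HodgeConjecture.HodgeConjecture.Theorems.K2LiuA7ValueInstanceTopology      -- ★ I-3 (K2Liu-p09): `continuous_leviRhoLoc_rhoLoc_apply`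
import Summits.HodgeConjecture.HodgeConjecture.Theorems.K2LiuA7ValueInstancePartnerLaws   -- ★ (K2Liu-p09): `continuous_rhoLoc`
import Summits.HodgeConjecture.HodgeConjecture.Theorems.K2LiuLeviActionSmoothCoeff        -- ★ V6-inst LETTER 1 (this seat): `continuous_coeff_leviEquivSB`
import HarnessLib

/-!
# Crux `HLiu418`, (σ) V6-inst LETTER 1b §2: the `hBcont` socket — `x ↦ B (leviEquivSB (ρ x) Φ) h` is continuous on `U(V′_v)` for EVERY linear `B`

Cell `hodgecm-mathlib`, crux item hLiu418 = `stmt-HodgeConjecture-24832` (helper lane `--supports`, count-neutral).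

* `continuous_rhoLoc_apply` — pointwise continuity `g ↦ ρ g u` of K2Liu-p09's partner action `rhoLoc` (from ★ `continuous_leviRhoLoc_rhoLoc_apply` at `a = 1`);
* **`continuous_coeff_leviEquivSB_rhoLoc`** — the socket `hBcont` of ★ `faceA4R_two_of_record_v2` VERBATIM (`leviEquivSB (rhoLoc … x) (continuous_rhoLoc … x).1 (continuous_rhoLoc … x).2 Φ`),
  for every ℂ-linear `B : 𝓢(X_Δ) →ₗ[ℂ] (H → ℂ)`, every `Φ`, `h` — by ★ LETTER 1 `continuous_coeff_leviEquivSB` (the orbit map is locally constant; no property of `B` used).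
References: [MoeglinVignerasWaldspurger1987, Chap. 2 II.6, II.8]; [Kudla1994, §3].
HONEST LABEL: HC_CM is proved only modulo the 7 printed citations (2 remaining named inputs: hLiu418 = stmt-HodgeConjecture-24832,
h413 = stmt-HodgeConjecture-24833) until rung 0 closes; count-neutral helper, closes no socket by itself (it discharges the `hBcont` binder).
-/

set_option autoImplicit false
set_option linter.dupNamespace false

noncomputable section

open scoped Matrix
open NumberField IsDedekindDomain Matrix Topology
open Literature.NumberTheory.Automorphic Literature.NumberTheory.Automorphic.UnitaryGroup
open Literature.NumberTheory.GelbartRogawski1991 Literature.NumberTheory.GelbartRogawski1991.GRConstruction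
open Literature.NumberTheory.GelbartRogawski1991.UnitaryDualPair
open Literature.RepresentationTheory.HeisenbergGroup
open Summit.HodgeConjecture.HodgeConjecture.Cruxes.HLiu418.K2LiuA7ValueInstanceDefs
open Summit.HodgeConjecture.HodgeConjecture.Cruxes.HLiu418.K2LiuA7ValueInstanceTopology
open Summit.HodgeConjecture.HodgeConjecture.Cruxes.HLiu418.K2LiuA7ValueInstancePartnerLaws
open Summit.HodgeConjecture.HodgeConjecture.Cruxes.HLiu418.K2LiuLeviActionSmoothCoeff

namespace Summit.HodgeConjecture.HodgeConjecture.Cruxes.HLiu418.K2LiuA7ValueInstanceCoeffContinuity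

variable (L : Type) [Field L] [NumberField L] [IsCMField L] [Algebra.IsQuadraticExtension (Fp L) L]
variable {N M n : ℕ} (e : Fin N × Fin M ≃ Fin n)
  (dV : Fin N → L) (hdV : ∀ i, IsCMField.complexConj L (dV i) = dV i)
  (dW : Fin M → L) (hdW : ∀ i, IsCMField.complexConj L (dW i) = dW i)
variable {M₂ M' n' : ℕ} (eW : Fin M × Fin M₂ ≃ Fin M') (e' : Fin N × Fin M' ≃ Fin n')
  (dV' : Fin M₂ → L) (hdV' : ∀ k, IsCMField.complexConj L (dV' k) = dV' k)
variable (v : HeightOneSpectrum (𝓞 (Fp L)))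

/-- **POINTWISE CONTINUITY OF THE PARTNER ACTION**: `g ↦ ρ g u` is continuous for every `u ∈ X_Δ` (★ `continuous_leviRhoLoc_rhoLoc_apply` at the Levi element `1`).
[MoeglinVignerasWaldspurger1987, Chap. 2 II.8] -/
theorem continuous_rhoLoc_apply {δ : L} (hcδ : IsCMField.complexConj L δ = -δ) (hδ : δ ≠ 0) (u : Fin (n' + n') → v.adicCompletion (Fp L)) :
    Continuous fun g : UnitaryGroup.localPi L (IsCMField.complexConj L) M₂ (Matrix.diagonal dV') v =>
      rhoLoc L hcδ hδ e dV hdV dW hdW eW e' dV' hdV' v g u := by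
  have h := (continuous_leviRhoLoc_rhoLoc_apply L hcδ hδ e dV hdV dW hdW eW e' dV' hdV' v).comp
    ((continuous_const.prodMk continuous_id).prodMk continuous_const :
      Continuous fun g : UnitaryGroup.localPi L (IsCMField.complexConj L) M₂ (Matrix.diagonal dV') v =>
        (((1 : ↥(leviDeltaLoc L e dV hdV dW hdW v)), g), u))
  refine h.congr fun g => ?_
  simp only [Function.comp_apply, map_one, LinearEquiv.coe_one, id_eq]

/-- **THE `hBcont` SOCKET OF ★ `faceA4R_two_of_record_v2`, DISCHARGED FOR EVERY LINEAR `B`**: `x ↦ B (leviEquivSB (ρ x) Φ) h` is continuous on `U(V′_v)`.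
[MoeglinVignerasWaldspurger1987, Chap. 2 II.6, II.8] [Kudla1994, §3] -/
theorem continuous_coeff_leviEquivSB_rhoLoc {H : Type*}
    (B : SchwartzBruhat (Fin (n' + n') → v.adicCompletion (Fp L)) →ₗ[ℂ] (H → ℂ)) (Φ : SchwartzBruhat (Fin (n' + n') → v.adicCompletion (Fp L))) (h : H) :
    Continuous fun x : UnitaryGroup.localPi L (IsCMField.complexConj L) M₂ (Matrix.diagonal dV') v =>
      B (leviEquivSB (rhoLoc L (complexConj_imagUnit L) (imagUnit_ne_zero L) e dV hdV dW hdW eW e' dV' hdV' v x)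
        (continuous_rhoLoc L e dV hdV dW hdW eW e' dV' hdV' v x).1 (continuous_rhoLoc L e dV hdV dW hdW eW e' dV' hdV' v x).2 Φ) h :=
  continuous_coeff_leviEquivSB (rhoLoc L (complexConj_imagUnit L) (imagUnit_ne_zero L) e dV hdV dW hdW eW e' dV' hdV' v)
    (continuous_rhoLoc_apply L e dV hdV dW hdW eW e' dV' hdV' v (complexConj_imagUnit L) (imagUnit_ne_zero L))
    (fun x => (continuous_rhoLoc L e dV hdV dW hdW eW e' dV' hdV' v x).1) (fun x => (continuous_rhoLoc L e dV hdV dW hdW eW e' dV' hdV' v x).2) B Φ h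

end Summit.HodgeConjecture.HodgeConjecture.Cruxes.HLiu418.K2LiuA7ValueInstanceCoeffContinuity

end
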